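import Summits.MatrixMultiplication.OmegaCensus.SmallFormats.RankOnePlaneCapGaugePositions
import Summits.MatrixMultiplication.OmegaCensus.SmallFormats.RankOnePlaneCapLattice
import HarnessLib

/-!
# ω-census family (a): the v1.2 gauge of the gauge-SAT instrument as ONE normal-form theorem

Cell `pub-omega` (unit `pub-omega-tensor`, gen 29), topic `Summits/MatrixMultiplication/OmegaCensus`
(sub-folder `SmallFormats`). Framing (verbatim): lottery ticket; floor = certified bounds/negative
ranges. HONEST FRAMING: assembly of the pieces landed in `RankOnePlaneCapColBlocks`,
`RankOnePlaneCapGaugeHeads`, `RankOnePlaneCapGaugePositions` into the single statement the `𝔽₃`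
`⟨2,2,5⟩@17` X-marginal census cites for every two-plane orbit (orbit 60420, GO #80; the residue,
GO #83–85): the case list {'line' × 13 Borel heads} ∪ {'zero' × 6 `GL₂` heads} of tensor-g28's
kitjob-gs (v1.2, `JOB_NORM3=0`) is EXHAUSTIVE. Not a bound on any rank, not progress on `ω`.

**Theorem** (`gauge_normal_form_v12`). Let `β` be a computation of `⟨2,2,5⟩` over `𝔽₃` with 17
products, and let `R₁`, `R₂` be disjoint sets of 4 products whose X-forms vanish on the column planes
`{z λ₁ᵀ}`, `{z λ₂ᵀ}` (`λ₁, λ₂ ≠ 0`; two SATURATED column planes, `2r − 6n = 4`), and `i₀` any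
product (the encoder takes the first product of `R₁`, whose output is then `[H | 0]`). Then
there is a computation `β'` of `⟨2,2,5⟩` with THE SAME X-forms (`β'.f = β.f`, so the same X-marginal)
such that every output of `R₁` is supported on columns `{0,1}` and `θ₁ᵀG'_i` (`i ∉ R₁`,
`θ₁ ⊥ λ₁`, `G'_i` the Y-coefficient matrix of `β'.g i`) vanishes in coordinates `0,1`, and EITHER
('line') every output of `R₂` is supported on columns `{0,2}`, `θ₂ᵀG'_i` (`i ∉ R₂`) vanishes in
coordinates `0,2`, and the head `(β'.w i₀)|_{cols 0,1}` is one of the 13 Borel forms, OR ('zero')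
every output of `R₂` is supported on columns `{2,3}`, `θ₂ᵀG'_i` vanishes in coordinates `2,3`, and
the head is one of the 6 `GL₂` forms — exactly the W- and G-side zero patterns + head cases of the
encoder. (The 'same' position is excluded inside the proof by `false_of_sameF`; the G-side uses
`coords_eq_zero_of_outputs_supported`: four independent outputs supported on a column pair span all
matrices supported there, so the law's `E` is the coordinate 3-space; the per-term sign rule of the
encoder is the separate, evidently lossless rescaling `(g_i, W_i) ↦ (−g_i, −W_i)`.)
-/

namespace Summit.MatrixMultiplication.OmegaCensus.RankOnePlaneCapGeneral

open Module Matrix Literature.Computability.AlgebraicComplexity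

variable {k : Type*} [Field k]

/-- The coordinate 3-space `{v : v₀ = v₁ = 0} ≤ k⁵` has dimension 3 (as a kernel). -/
theorem exists_coordSpace234 :
    ∃ E : Submodule k (Fin 5 → k), finrank k E = 3 ∧ ∀ v, v ∈ E ↔ v 0 = 0 ∧ v 1 = 0 := by
  let π : (Fin 5 → k) →ₗ[k] (k × k) := (LinearMap.proj 0).prod (LinearMap.proj 1)
  refine ⟨LinearMap.ker π, ?_, fun v => ?_⟩
  · have hsurj : LinearMap.range π = ⊤ := by
      rw [LinearMap.range_eq_top]
      rintro ⟨a, b⟩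
      refine ⟨Pi.single 0 a + Pi.single 1 b, ?_⟩
      simp [π]
    have h := LinearMap.finrank_range_add_finrank_ker π
    rw [hsurj, finrank_top, Module.finrank_prod, Module.finrank_self, Module.finrank_fin_fun] at h
    omega
  · simp [π]

/-- The `2 × 2` head (columns `0,1`) of a `2 × 5` output. -/
theorem head_mul_eq (W : Matrix (Fin 2) (Fin 5) k) (N : Matrix (Fin 2) (Fin 2) k)
    (W' : Matrix (Fin 2) (Fin 5) k)
    (h0 : ∀ κ, W' κ 0 = (![W κ 0, W κ 1] ᵥ* N) 0) (h1 : ∀ κ, W' κ 1 = (![W κ 0, W κ 1] ᵥ* N) 1) :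
    !![W' 0 0, W' 0 1; W' 1 0, W' 1 1] = !![W 0 0, W 0 1; W 1 0, W 1 1] * N := by
  ext κ j
  fin_cases κ <;> fin_cases j <;>
    simp [h0, h1, Matrix.mul_apply, Matrix.vecMul, dotProduct, Fin.sum_univ_two]

variable {ι : Type*} [Fintype ι]

omit [Fintype ι] in
/-- **G-side of the gauge.** If the four outputs `W_i`, `i ∈ R`, of a saturated column plane are
linearly independent and supported on the column pair `{c₁, c₂}`, then they span ALL matrices
supported there, so the law's space `E` (`rows(Y') ⊆ E ⇔ Y' ⊥ W_i ∀ i ∈ R`) lies inside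
`{v : v_{c₁} = v_{c₂} = 0}` — in the gauge `F′ = ⟨e_{c₁}, e_{c₂}⟩` one has `E = F′^⊥` on the nose, i.e.
`θᵀG_i` has vanishing coordinates `c₁, c₂` for `i ∉ R` (the encoder's `G`-side zero pattern). -/
theorem coords_eq_zero_of_outputs_supported {W : ι → Matrix (Fin 2) (Fin 5) k} (R : Finset ι)
    (hli : LinearIndependent k (fun i : {i // i ∈ R} => W i.1)) (hcard : R.card = 4)
    {c₁ c₂ : Fin 5} (hsupp : ∀ i ∈ R, ∀ κ ν, ν ≠ c₁ → ν ≠ c₂ → W i κ ν = 0)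
    (E : Submodule k (Fin 5 → k))
    (hchar : ∀ Y' : Matrix (Fin 2) (Fin 5) k,
      (∀ i ∈ R, (∑ κ, ∑ ν, W i κ ν * Y' κ ν) = 0) ↔ ∀ κ, Y' κ ∈ E)
    {v : Fin 5 → k} (hv : v ∈ E) : v c₁ = 0 ∧ v c₂ = 0 := by
  classical
  -- the 2×2 blocks of the outputs form a basis of `k^{2×2}`
  let cs : Fin 2 → Fin 5 := ![c₁, c₂]
  let blk : Matrix (Fin 2) (Fin 5) k →ₗ[k] Matrix (Fin 2) (Fin 2) k :=
    { toFun := fun M => Matrix.of fun κ j => M κ (cs j)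
      map_add' := fun M N => by ext κ j; rfl
      map_smul' := fun a M => by ext κ j; rfl }
  have hinjS : ∀ M : Matrix (Fin 2) (Fin 5) k, (∀ κ ν, ν ≠ c₁ → ν ≠ c₂ → M κ ν = 0) →
      blk M = 0 → M = 0 := by
    intro M hM h0
    ext κ ν
    by_cases h1 : ν = c₁
    · have := congrFun (congrFun h0 κ) 0
      simp only [blk, LinearMap.coe_mk, AddHom.coe_mk, Matrix.of_apply, Matrix.zero_apply] at this
      rw [h1]; simpa [cs] using this
    by_cases h2 : ν = c₂
    · have := congrFun (congrFun h0 κ) 1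
      simp only [blk, LinearMap.coe_mk, AddHom.coe_mk, Matrix.of_apply, Matrix.zero_apply] at this
      rw [h2]; simpa [cs] using this
    exact hM κ ν h1 h2
  have hliB : LinearIndependent k (fun i : {i // i ∈ R} => blk (W i.1)) := by
    rw [Fintype.linearIndependent_iff]
    intro g hg
    have hsum : blk (∑ i, g i • W i.1) = 0 := by rw [map_sum]; simpa [map_smul] using hg
    have hzero : ∑ i : {i // i ∈ R}, g i • W i.1 = 0 := by
      refine hinjS _ (fun κ ν h1 h2 => ?_) hsum
      simp only [Matrix.sum_apply, Matrix.smul_apply, smul_eq_mul]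
      exact Finset.sum_eq_zero fun i _ => by rw [hsupp i.1 i.2 κ ν h1 h2, mul_zero]
    exact (Fintype.linearIndependent_iff.mp hli) g hzero
  have hcardB : Fintype.card {i // i ∈ R} = finrank k (Matrix (Fin 2) (Fin 2) k) := by
    rw [Fintype.card_coe, hcard, Module.finrank_matrix]; simp
  haveI : Nonempty {i // i ∈ R} := by
    rw [← Fintype.card_pos_iff, Fintype.card_coe, hcard]; norm_num
  let bB := basisOfLinearIndependentOfCardEqFinrank hliB hcardB
  -- every functional killing all `W_i` kills every matrix supported on `{c₁, c₂}`:
  -- apply to `Y' = e_κ vᵀ` (rows in `E`) and the matrices `single κ c`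
  have hY : ∀ κ₀ : Fin 2, ∀ i ∈ R,
      (∑ κ, ∑ ν, W i κ ν * vecMulVec (Pi.single κ₀ (1 : k)) v κ ν) = 0 := by
    intro κ₀
    refine (hchar _).mpr fun κ => ?_
    by_cases h : κ = κ₀
    · have : vecMulVec (Pi.single κ₀ (1 : k)) v κ = v := by
        funext ν; simp [vecMulVec_apply, h]
      rw [this]; exact hv
    · have : vecMulVec (Pi.single κ₀ (1 : k)) v κ = 0 := by
        funext ν; simp [vecMulVec_apply, h]
      rw [this]; exact E.zero_mem
  -- the pairing with `e_{κ₀} vᵀ` as a linear functional on matrices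
  have key : ∀ (κ₀ : Fin 2) (j : Fin 2), v (cs j) = 0 := by
    intro κ₀ j
    let φ : Matrix (Fin 2) (Fin 5) k →ₗ[k] k :=
      { toFun := fun M => ∑ κ, ∑ ν, M κ ν * vecMulVec (Pi.single κ₀ (1 : k)) v κ ν
        map_add' := fun M N => by
          simp only [Matrix.add_apply, add_mul, Finset.sum_add_distrib]
        map_smul' := fun a M => by
          simp only [Matrix.smul_apply, smul_eq_mul, RingHom.id_apply, Finset.mul_sum, mul_assoc] }
    -- the matrix `single κ₀ (cs j)` is a combination of the `W_i` (via the block basis)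
    let S : Matrix (Fin 2) (Fin 5) k := Matrix.single κ₀ (cs j) (1 : k)
    have hSsupp : ∀ κ ν, ν ≠ c₁ → ν ≠ c₂ → S κ ν = 0 := by
      intro κ ν h1 h2
      have hne : cs j ≠ ν := by
        fin_cases j
        · exact fun h => h1 h.symm
        · exact fun h => h2 h.symm
      simp [S, Matrix.single, hne]
    obtain ⟨g, hg⟩ : ∃ g : {i // i ∈ R} → k, ∑ i, g i • W i.1 = S := by
      refine ⟨fun i => bB.repr (blk S) i, ?_⟩
      have hbB : ∀ i, bB i = blk (W i.1) := fun i => by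
        simp [bB, coe_basisOfLinearIndependentOfCardEqFinrank]
      have hblk : blk (∑ i, (bB.repr (blk S) i) • W i.1) = blk S := by
        rw [map_sum]
        simp only [map_smul, ← hbB]
        exact bB.sum_repr (blk S)
      have hdiff : (∑ i, (bB.repr (blk S) i) • W i.1) - S = 0 := by
        refine hinjS _ (fun κ ν h1 h2 => ?_) (by rw [map_sub, hblk, sub_self])
        simp only [Matrix.sub_apply, Matrix.sum_apply, Matrix.smul_apply, smul_eq_mul]
        rw [hSsupp κ ν h1 h2,
          Finset.sum_eq_zero (fun i _ => by rw [hsupp i.1 i.2 κ ν h1 h2, mul_zero]), sub_zero]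
      exact sub_eq_zero.mp hdiff
    have hφW : ∀ i ∈ R, φ (W i) = 0 := fun i hi => hY κ₀ i hi
    have hφS : φ S = 0 := by
      rw [← hg, map_sum]
      exact Finset.sum_eq_zero fun i _ => by rw [map_smul, hφW i.1 i.2, smul_zero]
    have : φ S = v (cs j) := by
      simp only [φ, S, LinearMap.coe_mk, AddHom.coe_mk]
      rw [Finset.sum_eq_single κ₀ (fun κ _ hκ => by simp [Matrix.single, Ne.symm hκ]) (by simp),
        Finset.sum_eq_single (cs j) (fun ν _ hν => by simp [Matrix.single, Ne.symm hν]) (by simp)]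
      simp [Matrix.single, vecMulVec_apply]
    rw [← this]; exact hφS
  exact ⟨by simpa [cs] using key 0 0, by simpa [cs] using key 0 1⟩

/-- Outputs after a column transform: `(W A') κ j = (W κ) A' j`. -/
theorem mul_apply_eq_vecMul (W : Matrix (Fin 2) (Fin 5) k) (A' : Matrix (Fin 5) (Fin 5) k)
    (κ : Fin 2) (j : Fin 5) : (W * A') κ j = (W κ ᵥ* A') j := rfl

/-- Support on a column pair, from the vanishing of the three other columns. -/
theorem supp_pair_of_zero_cols (W : Matrix (Fin 2) (Fin 5) k) {c₁ c₂ j₁ j₂ j₃ : Fin 5}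
    (hcover : ∀ ν : Fin 5, ν ≠ c₁ → ν ≠ c₂ → ν = j₁ ∨ ν = j₂ ∨ ν = j₃)
    (h : ∀ κ, W κ j₁ = 0 ∧ W κ j₂ = 0 ∧ W κ j₃ = 0) :
    ∀ κ ν, ν ≠ c₁ → ν ≠ c₂ → W κ ν = 0 := by
  intro κ ν h1 h2
  rcases hcover ν h1 h2 with h' | h' | h' <;> rw [h']
  exacts [(h κ).1, (h κ).2.1, (h κ).2.2]

/-- **G-side zero pattern** of a saturated column plane in the gauge: if the outputs of `R`
(`|R| = 4`, X-forms vanishing on `{z λᵀ}`) are supported on the column pair `{c₁, c₂}`, then for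
the law's `θ ⊥ λ` every `θᵀG_i`, `i ∉ R`, has vanishing coordinates `c₁` and `c₂`. -/
theorem gside_of_supported [DecidableEq ι] (h17 : Fintype.card ι = 17)
    (β : BilinComp (mulBilin (ZMod 3) 2 2 5) ι) {lam : Fin 2 → ZMod 3} (hlam : lam ≠ 0)
    (R : Finset ι) (hR : ∀ i ∈ R, ∀ z : Fin 2 → ZMod 3, β.f i (vecMulVec z lam) = 0)
    (hc : R.card = 4) {c₁ c₂ : Fin 5}
    (hsupp : ∀ i ∈ R, ∀ κ ν, ν ≠ c₁ → ν ≠ c₂ → β.w i κ ν = 0) :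
    ∃ θ : Fin 2 → ZMod 3, θ ≠ 0 ∧ θ ⬝ᵥ lam = 0 ∧ ∀ i, i ∉ R →
      (θ ᵥ* Matrix.of fun μ ν => β.g i (Matrix.single μ ν (1 : ZMod 3))) c₁ = 0 ∧
      (θ ᵥ* Matrix.of fun μ ν => β.g i (Matrix.single μ ν (1 : ZMod 3))) c₂ = 0 := by
  classical
  obtain ⟨θ, E, hθ, hθlam, hE, -, hchar, hli⟩ :=
    card_vanishing_col_eq_two_mul_sub β hlam R hR (by rw [h17]; omega)
  refine ⟨θ, hθ, hθlam, fun i hi => ?_⟩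
  have hmem : (θ ᵥ* Matrix.of fun μ ν => β.g i (Matrix.single μ ν (1 : ZMod 3))) ∈ E := by
    rw [hE]
    exact Submodule.subset_span ⟨i, by simp [hi], rfl⟩
  exact coords_eq_zero_of_outputs_supported R hli hc hsupp E hchar hmem

/-- **The v1.2 gauge normal form** (two saturated column planes, `𝔽₃`, `⟨2,2,5⟩`, 17 products).
See the module doc-string. -/
theorem gauge_normal_form_v12 [DecidableEq ι] (h17 : Fintype.card ι = 17)
    (β : BilinComp (mulBilin (ZMod 3) 2 2 5) ι) {lam₁ lam₂ : Fin 2 → ZMod 3}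
    (hlam₁ : lam₁ ≠ 0) (hlam₂ : lam₂ ≠ 0) (R₁ R₂ : Finset ι) (hdisj : Disjoint R₁ R₂)
    (hR₁ : ∀ i ∈ R₁, ∀ z : Fin 2 → ZMod 3, β.f i (vecMulVec z lam₁) = 0)
    (hR₂ : ∀ i ∈ R₂, ∀ z : Fin 2 → ZMod 3, β.f i (vecMulVec z lam₂) = 0)
    (hc₁ : R₁.card = 4) (hc₂ : R₂.card = 4) (i₀ : ι) :
    ∃ β' : BilinComp (mulBilin (ZMod 3) 2 2 5) ι,
      (∀ i, β'.f i = β.f i) ∧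
      (∀ i ∈ R₁, ∀ κ, β'.w i κ 2 = 0 ∧ β'.w i κ 3 = 0 ∧ β'.w i κ 4 = 0) ∧
      (∃ θ₁ : Fin 2 → ZMod 3, θ₁ ≠ 0 ∧ θ₁ ⬝ᵥ lam₁ = 0 ∧ ∀ i, i ∉ R₁ →
        (θ₁ ᵥ* Matrix.of fun μ ν => β'.g i (Matrix.single μ ν (1 : ZMod 3))) 0 = 0 ∧
        (θ₁ ᵥ* Matrix.of fun μ ν => β'.g i (Matrix.single μ ν (1 : ZMod 3))) 1 = 0) ∧
      (((∀ i ∈ R₂, ∀ κ, β'.w i κ 1 = 0 ∧ β'.w i κ 3 = 0 ∧ β'.w i κ 4 = 0) ∧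
          (∃ θ₂ : Fin 2 → ZMod 3, θ₂ ≠ 0 ∧ θ₂ ⬝ᵥ lam₂ = 0 ∧ ∀ i, i ∉ R₂ →
            (θ₂ ᵥ* Matrix.of fun μ ν => β'.g i (Matrix.single μ ν (1 : ZMod 3))) 0 = 0 ∧
            (θ₂ ᵥ* Matrix.of fun μ ν => β'.g i (Matrix.single μ ν (1 : ZMod 3))) 2 = 0) ∧
          !![β'.w i₀ 0 0, β'.w i₀ 0 1; β'.w i₀ 1 0, β'.w i₀ 1 1] ∈
            ([!![0, 0; 0, 0], !![0, 0; 1, 0], !![0, 0; 0, 1], !![1, 0; 0, 0], !![1, 0; 1, 0],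
              !![1, 0; 2, 0], !![0, 1; 0, 0], !![0, 1; 0, 1], !![0, 1; 0, 2], !![1, 0; 0, 1],
              !![0, 1; 1, 0], !![0, 1; 1, 1], !![0, 1; 1, 2]] :
              List (Matrix (Fin 2) (Fin 2) (ZMod 3)))) ∨
       ((∀ i ∈ R₂, ∀ κ, β'.w i κ 0 = 0 ∧ β'.w i κ 1 = 0 ∧ β'.w i κ 4 = 0) ∧
          (∃ θ₂ : Fin 2 → ZMod 3, θ₂ ≠ 0 ∧ θ₂ ⬝ᵥ lam₂ = 0 ∧ ∀ i, i ∉ R₂ →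
            (θ₂ ᵥ* Matrix.of fun μ ν => β'.g i (Matrix.single μ ν (1 : ZMod 3))) 2 = 0 ∧
            (θ₂ ᵥ* Matrix.of fun μ ν => β'.g i (Matrix.single μ ν (1 : ZMod 3))) 3 = 0) ∧
          !![β'.w i₀ 0 0, β'.w i₀ 0 1; β'.w i₀ 1 0, β'.w i₀ 1 1] ∈
            ([!![0, 0; 0, 0], !![1, 0; 0, 0], !![1, 0; 1, 0], !![1, 0; 2, 0], !![0, 0; 1, 0],
              !![1, 0; 0, 1]] : List (Matrix (Fin 2) (Fin 2) (ZMod 3))))) := by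
  classical
  -- the two column laws: outputs of `R_j` kill a 3-space `E_j`
  have hcR : ∀ R : Finset ι, (Finset.univ \ R).card + R.card = Fintype.card ι := fun R => by
    rw [Finset.card_sdiff_add_card_eq_card (Finset.subset_univ R), Finset.card_univ]
  obtain ⟨θ₁, E₁, -, -, -, hdim₁, hchar₁, -⟩ :=
    card_vanishing_col_eq_two_mul_sub β hlam₁ R₁ hR₁ (by rw [h17]; omega)
  obtain ⟨θ₂, E₂, -, -, -, hdim₂, hchar₂, -⟩ :=
    card_vanishing_col_eq_two_mul_sub β hlam₂ R₂ hR₂ (by rw [h17]; omega)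
  have hE₁ : finrank (ZMod 3) E₁ = 3 := by have := hcR R₁; omega
  have hE₂ : finrank (ZMod 3) E₂ = 3 := by have := hcR R₂; omega
  have hkill₁ : ∀ i ∈ R₁, ∀ v ∈ E₁, β.w i *ᵥ v = 0 := fun i hi v hv =>
    mulVec_eq_zero_of_orth_iff R₁ E₁ hchar₁ hi hv
  have hkill₂ : ∀ i ∈ R₂, ∀ v ∈ E₂, β.w i *ᵥ v = 0 := fun i hi v hv =>
    mulVec_eq_zero_of_orth_iff R₂ E₂ hchar₂ hi hv
  -- positions
  obtain ⟨A, A', β₁, -, -, hf₁, -, -, hpos₁, hpos₂⟩ :=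
    exists_gauge_normal_form_225 β E₁ E₂ hE₁ hE₂ R₁ R₂ hkill₁ hkill₂
  -- the head step: transform by `diag(N, I₃)` for a normalising `N`
  have head_step : ∀ (N : Matrix (Fin 2) (Fin 2) (ZMod 3)), IsUnit N.det →
      ∃ β₂ : BilinComp (mulBilin (ZMod 3) 2 2 5) ι, (∀ i, β₂.f i = β.f i) ∧
        (∀ i κ, β₂.w i κ 2 = β₁.w i κ 2 ∧ β₂.w i κ 3 = β₁.w i κ 3 ∧ β₂.w i κ 4 = β₁.w i κ 4 ∧
          β₂.w i κ 0 = (![β₁.w i κ 0, β₁.w i κ 1] ᵥ* N) 0 ∧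
          β₂.w i κ 1 = (![β₁.w i κ 0, β₁.w i κ 1] ᵥ* N) 1) ∧
        (N 0 1 = 0 → ∀ i κ, β₁.w i κ 1 = 0 → β₂.w i κ 1 = 0) := by
    intro N hN
    obtain ⟨hMM', -, -, -⟩ := blockDiag_fin5_gauge N⁻¹ N (Matrix.nonsing_inv_mul N hN)
    obtain ⟨-, hsame, -, hline⟩ := blockDiag_fin5_gauge N N⁻¹ (Matrix.mul_nonsing_inv N hN)
    obtain ⟨β₂, hf₂, -, hw₂⟩ := exists_colTransform β₁ _ _ hMM'
    refine ⟨β₂, fun i => by rw [hf₂, hf₁], fun i κ => ?_, fun hB i κ h1 => ?_⟩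
    · obtain ⟨e0, e1, e2, e3, e4⟩ := blockDiag_fin5_apply N (β₁.w i κ)
      simp only [hw₂, mul_apply_eq_vecMul]
      refine ⟨e2, e3, e4, ?_, ?_⟩
      · rw [e0]; simp [Matrix.vecMul, dotProduct, Fin.sum_univ_two]
      · rw [e1]; simp [Matrix.vecMul, dotProduct, Fin.sum_univ_two]
    · obtain ⟨e0, e1, e2, e3, e4⟩ := blockDiag_fin5_apply N (β₁.w i κ)
      simp only [hw₂, mul_apply_eq_vecMul]
      rw [e1, h1, hB]; ring
  rcases hpos₂ with hsame | hline | hzero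
  · -- 'same': impossible
    exfalso
    obtain ⟨E, hE3, hmemE⟩ := exists_coordSpace234 (k := ZMod 3)
    refine false_of_sameF β₁ (by rw [h17]; norm_num) E (by rw [h17, hE3]) (R₁ ∪ R₂)
      (by rw [Finset.card_union_of_disjoint hdisj, h17]; omega) ?_
    intro i hi v hv
    obtain ⟨hv0, hv1⟩ := (hmemE v).mp hv
    have hsupp : ∀ κ, β₁.w i κ 2 = 0 ∧ β₁.w i κ 3 = 0 ∧ β₁.w i κ 4 = 0 := by
      rcases Finset.mem_union.mp hi with h | h
      · exact hpos₁ i h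
      · exact hsame i h
    ext κ
    obtain ⟨h2, h3, h4⟩ := hsupp κ
    simp [Matrix.mulVec, dotProduct, Fin.sum_univ_five, hv0, hv1, h2, h3, h4]
  · -- 'line': Borel head normal form
    obtain ⟨p, r, s, hdet, hmem⟩ :=
      head_canonical_borel_gf3 (β₁.w i₀ 0 0) (β₁.w i₀ 0 1) (β₁.w i₀ 1 0) (β₁.w i₀ 1 1)
    have hN : IsUnit (!![p, 0; r, s] : Matrix (Fin 2) (Fin 2) (ZMod 3)).det := by
      rw [Matrix.det_fin_two_of, isUnit_iff_ne_zero]; simpa using hdet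
    obtain ⟨β₂, hf₂, hw₂, hB⟩ := head_step _ hN
    have hs₁ : ∀ i ∈ R₁, ∀ κ, β₂.w i κ 2 = 0 ∧ β₂.w i κ 3 = 0 ∧ β₂.w i κ 4 = 0 := by
      intro i hi κ
      obtain ⟨e2, e3, e4, -, -⟩ := hw₂ i κ
      obtain ⟨h2, h3, h4⟩ := hpos₁ i hi κ
      exact ⟨by rw [e2, h2], by rw [e3, h3], by rw [e4, h4]⟩
    have hs₂ : ∀ i ∈ R₂, ∀ κ, β₂.w i κ 1 = 0 ∧ β₂.w i κ 3 = 0 ∧ β₂.w i κ 4 = 0 := by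
      intro i hi κ
      obtain ⟨e2, e3, e4, -, -⟩ := hw₂ i κ
      obtain ⟨h1, h3, h4⟩ := hline i hi κ
      exact ⟨hB rfl i κ h1, by rw [e3, h3], by rw [e4, h4]⟩
    have hR₁' : ∀ i ∈ R₁, ∀ z : Fin 2 → ZMod 3, β₂.f i (vecMulVec z lam₁) = 0 :=
      fun i hi z => by rw [hf₂]; exact hR₁ i hi z
    have hR₂' : ∀ i ∈ R₂, ∀ z : Fin 2 → ZMod 3, β₂.f i (vecMulVec z lam₂) = 0 :=
      fun i hi z => by rw [hf₂]; exact hR₂ i hi z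
    refine ⟨β₂, hf₂, hs₁, gside_of_supported h17 β₂ hlam₁ R₁ hR₁' hc₁
      (fun i hi => supp_pair_of_zero_cols (β₂.w i) (c₁ := 0) (c₂ := 1) (j₁ := 2) (j₂ := 3)
        (j₃ := 4) (by decide) (hs₁ i hi)), Or.inl ⟨hs₂, gside_of_supported h17 β₂ hlam₂ R₂ hR₂' hc₂
      (fun i hi => supp_pair_of_zero_cols (β₂.w i) (c₁ := 0) (c₂ := 2) (j₁ := 1) (j₂ := 3)
        (j₃ := 4) (by decide) (hs₂ i hi)), ?_⟩⟩
    rw [head_mul_eq (β₁.w i₀) !![p, 0; r, s] (β₂.w i₀) (fun κ => (hw₂ i₀ κ).2.2.2.1)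
      (fun κ => (hw₂ i₀ κ).2.2.2.2)]
    exact hmem
  · -- 'zero': GL₂ head normal form
    obtain ⟨p, q, r, s, hdet, hmem⟩ :=
      head_canonical_GL2_gf3 (β₁.w i₀ 0 0) (β₁.w i₀ 0 1) (β₁.w i₀ 1 0) (β₁.w i₀ 1 1)
    have hN : IsUnit (!![p, q; r, s] : Matrix (Fin 2) (Fin 2) (ZMod 3)).det := by
      rw [Matrix.det_fin_two_of, isUnit_iff_ne_zero]; simpa using hdet
    obtain ⟨β₂, hf₂, hw₂, -⟩ := head_step _ hN
    have hs₁ : ∀ i ∈ R₁, ∀ κ, β₂.w i κ 2 = 0 ∧ β₂.w i κ 3 = 0 ∧ β₂.w i κ 4 = 0 := by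
      intro i hi κ
      obtain ⟨e2, e3, e4, -, -⟩ := hw₂ i κ
      obtain ⟨h2, h3, h4⟩ := hpos₁ i hi κ
      exact ⟨by rw [e2, h2], by rw [e3, h3], by rw [e4, h4]⟩
    have hs₂ : ∀ i ∈ R₂, ∀ κ, β₂.w i κ 0 = 0 ∧ β₂.w i κ 1 = 0 ∧ β₂.w i κ 4 = 0 := by
      intro i hi κ
      obtain ⟨e2, e3, e4, e0, e1⟩ := hw₂ i κ
      obtain ⟨h0, h1, h4⟩ := hzero i hi κ
      refine ⟨?_, ?_, by rw [e4, h4]⟩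
      · rw [e0, h0, h1]; simp [Matrix.vecMul, dotProduct, Fin.sum_univ_two]
      · rw [e1, h0, h1]; simp [Matrix.vecMul, dotProduct, Fin.sum_univ_two]
    have hR₁' : ∀ i ∈ R₁, ∀ z : Fin 2 → ZMod 3, β₂.f i (vecMulVec z lam₁) = 0 :=
      fun i hi z => by rw [hf₂]; exact hR₁ i hi z
    have hR₂' : ∀ i ∈ R₂, ∀ z : Fin 2 → ZMod 3, β₂.f i (vecMulVec z lam₂) = 0 :=
      fun i hi z => by rw [hf₂]; exact hR₂ i hi z
    refine ⟨β₂, hf₂, hs₁, gside_of_supported h17 β₂ hlam₁ R₁ hR₁' hc₁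
      (fun i hi => supp_pair_of_zero_cols (β₂.w i) (c₁ := 0) (c₂ := 1) (j₁ := 2) (j₂ := 3)
        (j₃ := 4) (by decide) (hs₁ i hi)), Or.inr ⟨hs₂, gside_of_supported h17 β₂ hlam₂ R₂ hR₂' hc₂
      (fun i hi => supp_pair_of_zero_cols (β₂.w i) (c₁ := 2) (c₂ := 3) (j₁ := 0) (j₂ := 1)
        (j₃ := 4) (by decide) (hs₂ i hi)), ?_⟩⟩
    rw [head_mul_eq (β₁.w i₀) !![p, q; r, s] (β₂.w i₀) (fun κ => (hw₂ i₀ κ).2.2.2.1)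
      (fun κ => (hw₂ i₀ κ).2.2.2.2)]
    exact hmem

/-- **The v1.2 gauge normal form, ONE saturated column plane** (the encoder's '6 cases' for orbits
with a single saturated plane): for every `𝔽₃`-computation of `⟨2,2,5⟩` with 17 products and a
4-set `R` of products whose X-forms vanish on `{z λᵀ}`, and any product `i₀`, there is a computation
with THE SAME X-forms whose `R`-outputs are supported on columns `{0,1}`, with `θᵀG'_i` (`i ∉ R`,
`θ ⊥ λ`) vanishing in coordinates `0,1`, and whose head `(β'.w i₀)|_{cols 0,1}` is one of the 6
`GL₂` forms. -/
theorem gauge_normal_form_v12_single [DecidableEq ι] (h17 : Fintype.card ι = 17)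
    (β : BilinComp (mulBilin (ZMod 3) 2 2 5) ι) {lam : Fin 2 → ZMod 3} (hlam : lam ≠ 0)
    (R : Finset ι) (hR : ∀ i ∈ R, ∀ z : Fin 2 → ZMod 3, β.f i (vecMulVec z lam) = 0)
    (hc : R.card = 4) (i₀ : ι) :
    ∃ β' : BilinComp (mulBilin (ZMod 3) 2 2 5) ι,
      (∀ i, β'.f i = β.f i) ∧
      (∀ i ∈ R, ∀ κ, β'.w i κ 2 = 0 ∧ β'.w i κ 3 = 0 ∧ β'.w i κ 4 = 0) ∧
      (∃ θ : Fin 2 → ZMod 3, θ ≠ 0 ∧ θ ⬝ᵥ lam = 0 ∧ ∀ i, i ∉ R →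
        (θ ᵥ* Matrix.of fun μ ν => β'.g i (Matrix.single μ ν (1 : ZMod 3))) 0 = 0 ∧
        (θ ᵥ* Matrix.of fun μ ν => β'.g i (Matrix.single μ ν (1 : ZMod 3))) 1 = 0) ∧
      !![β'.w i₀ 0 0, β'.w i₀ 0 1; β'.w i₀ 1 0, β'.w i₀ 1 1] ∈
        ([!![0, 0; 0, 0], !![1, 0; 0, 0], !![1, 0; 1, 0], !![1, 0; 2, 0], !![0, 0; 1, 0],
          !![1, 0; 0, 1]] : List (Matrix (Fin 2) (Fin 2) (ZMod 3))) := by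
  classical
  have hcR : (Finset.univ \ R).card + R.card = Fintype.card ι := by
    rw [Finset.card_sdiff_add_card_eq_card (Finset.subset_univ R), Finset.card_univ]
  obtain ⟨θ, E, -, -, -, hdim, hchar, -⟩ := card_vanishing_col_eq_two_mul_sub β hlam R hR (by omega)
  have hE : finrank (ZMod 3) E = 3 := by omega
  have hkill : ∀ i ∈ R, ∀ v ∈ E, β.w i *ᵥ v = 0 := fun i hi v hv =>
    mulVec_eq_zero_of_orth_iff R E hchar hi hv
  -- position: use the pair normal form with `U₂ = U₁`; every branch puts the `R`-outputs on `{0,1}`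
  obtain ⟨A, A', β₁, -, -, hf₁, -, -, hpos, -⟩ :=
    exists_gauge_normal_form_225 β E E hE hE R R hkill hkill
  -- head: `GL₂` normal form, extended block-diagonally (keeps the `{0,1}` support)
  obtain ⟨p, q, r, s, hdet, hmem⟩ :=
    head_canonical_GL2_gf3 (β₁.w i₀ 0 0) (β₁.w i₀ 0 1) (β₁.w i₀ 1 0) (β₁.w i₀ 1 1)
  set N : Matrix (Fin 2) (Fin 2) (ZMod 3) := !![p, q; r, s] with hNdef
  have hN : IsUnit N.det := by
    rw [hNdef, Matrix.det_fin_two_of, isUnit_iff_ne_zero]; simpa using hdet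
  obtain ⟨hMM', -, -, -⟩ := blockDiag_fin5_gauge N⁻¹ N (Matrix.nonsing_inv_mul N hN)
  obtain ⟨β₂, hf₂, -, hw₂⟩ := exists_colTransform β₁ _ _ hMM'
  have hrows : ∀ i κ, β₂.w i κ 2 = β₁.w i κ 2 ∧ β₂.w i κ 3 = β₁.w i κ 3 ∧
      β₂.w i κ 4 = β₁.w i κ 4 ∧ β₂.w i κ 0 = (![β₁.w i κ 0, β₁.w i κ 1] ᵥ* N) 0 ∧
      β₂.w i κ 1 = (![β₁.w i κ 0, β₁.w i κ 1] ᵥ* N) 1 := fun i κ => by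
    obtain ⟨e0, e1, e2, e3, e4⟩ := blockDiag_fin5_apply N (β₁.w i κ)
    simp only [hw₂, mul_apply_eq_vecMul]
    exact ⟨e2, e3, e4, by rw [e0]; simp [Matrix.vecMul, dotProduct, Fin.sum_univ_two],
      by rw [e1]; simp [Matrix.vecMul, dotProduct, Fin.sum_univ_two]⟩
  have hs : ∀ i ∈ R, ∀ κ, β₂.w i κ 2 = 0 ∧ β₂.w i κ 3 = 0 ∧ β₂.w i κ 4 = 0 := fun i hi κ => by
    obtain ⟨e2, e3, e4, -, -⟩ := hrows i κ; obtain ⟨h2, h3, h4⟩ := hpos i hi κ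
    exact ⟨by rw [e2, h2], by rw [e3, h3], by rw [e4, h4]⟩
  have hf : ∀ i, β₂.f i = β.f i := fun i => by rw [hf₂, hf₁]
  have hR' : ∀ i ∈ R, ∀ z, β₂.f i (vecMulVec z lam) = 0 := fun i hi z => by rw [hf]; exact hR i hi z
  refine ⟨β₂, hf, hs, gside_of_supported h17 β₂ hlam R hR' hc
    (fun i hi => supp_pair_of_zero_cols (β₂.w i) (c₁ := 0) (c₂ := 1) (j₁ := 2) (j₂ := 3)
      (j₃ := 4) (by decide) (hs i hi)), ?_⟩
  rw [head_mul_eq (β₁.w i₀) N (β₂.w i₀) (fun κ => (hrows i₀ κ).2.2.2.1)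
    (fun κ => (hrows i₀ κ).2.2.2.2), hNdef]
  exact hmem
end Summit.MatrixMultiplication.OmegaCensus.RankOnePlaneCapGeneral
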